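import Summits.Ventures.PackingBounds.Energy.FivePointQuarticGramOne
import HarnessLib

/-!
# `(1+t)^4`, five points (d = 4 certificate): the SOS Gram block of the term `1` is positive DEFINITE with an explicit margin; face-basis vanishing

Framing: lottery ticket; floor = certified bounds/negative ranges. Venture `PackingBounds`, cell
`pub-packcert`, energy family E3PT (pub-packcert-energy gen 12) — groundwork for the rigidity of the
`(1+t)^k` certificates (no Hermite-minorant step there): the landed weighted-squares decomposition
`quad_1_eqQ4` (gen 11) has a diagonal remainder `dg_1_0Q4` with all weights `> 1/2000`, hence
`quad_1Q4 y ≥ (1/2000)·Σ_{i<28} y_i²`; so `quad_1Q4 (wv_1Q4 u v t) = 0` forces every face-basis polynomial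
to vanish, in particular `wv_1Q4 u v t 0 = t(t+1)(t+1/2) = 0`, i.e. `t ∈ {0, -1, -1/2}` (and `v` likewise
from `wv_1Q4 u v t 6`). Remaining steps for `ck4_five_points_rigid` (successor): termwise vanishing of the
slack over distinct triples from `ThreePointDeficit`, `Σ x = 0` from `a₁ > 0`, `Bipyramid5.rigid`.
-/

noncomputable section

namespace Summit.Ventures.PackingBounds.Energy.FivePointQuartic

open Finset

/-- **Margin:** `(1/2000)·Σ_{i<28} y_i² ≤ quad_1Q4 y` (from the diagonal remainder of the landed SOS decomposition). -/
theorem quad_1_marginQ4 (y : ℕ → ℝ) : (1 / 2000 : ℝ) * ∑ i ∈ range 28, y i ^ 2 ≤ quad_1Q4 y := by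
  rw [quad_1_eqQ4]
  unfold sos_1Q4
  have h0 := sq_1_0_nonnegQ4 y
  have h1 := sq_1_1_nonnegQ4 y
  have h2 := sq_1_2_nonnegQ4 y
  have h3 := pr_1_0_nonnegQ4 y
  have h4 := pr_1_1_nonnegQ4 y
  have hd : (1 / 2000 : ℝ) * ∑ i ∈ range 28, y i ^ 2 ≤ dg_1_0Q4 y := by
    unfold dg_1_0Q4
    simp only [Finset.sum_range_succ, Finset.sum_range_zero, zero_add]
    linarith [sq_nonneg (y 0), sq_nonneg (y 1), sq_nonneg (y 2), sq_nonneg (y 3), sq_nonneg (y 4), sq_nonneg (y 5), sq_nonneg (y 6), sq_nonneg (y 7), sq_nonneg (y 8), sq_nonneg (y 9), sq_nonneg (y 10), sq_nonneg (y 11), sq_nonneg (y 12), sq_nonneg (y 13), sq_nonneg (y 14), sq_nonneg (y 15), sq_nonneg (y 16), sq_nonneg (y 17), sq_nonneg (y 18), sq_nonneg (y 19), sq_nonneg (y 20), sq_nonneg (y 21), sq_nonneg (y 22), sq_nonneg (y 23), sq_nonneg (y 24), sq_nonneg (y 25), sq_nonneg (y 26), sq_nonneg (y 27)]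
  linarith

/-- If the Gram form vanishes at the face basis, the face polynomial `wv_1Q4 · 0 = t/2 + 3t²/2 + t³` vanishes: `t ∈ {0, -1, -1/2}`. -/
theorem t_of_quad_wv_eq_zeroQ4 (u v t : ℝ) (h : quad_1Q4 (wv_1Q4 u v t) = 0) : t = 0 ∨ t = -1 ∨ t = -1 / 2 := by
  have hm := quad_1_marginQ4 (wv_1Q4 u v t)
  rw [h] at hm
  have hle : (wv_1Q4 u v t 0) ^ 2 ≤ ∑ i ∈ range 28, (wv_1Q4 u v t i) ^ 2 :=
    Finset.single_le_sum (f := fun i => (wv_1Q4 u v t i) ^ 2) (fun i _ => sq_nonneg _) (by simp)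
  have hz : wv_1Q4 u v t 0 = 0 := by nlinarith [sq_nonneg (wv_1Q4 u v t 0)]
  have hp : ((1 : ℝ)/2) * t + ((3 : ℝ)/2) * t ^ 2 + (1 : ℝ) * t ^ 3 = 0 := by
    have := hz; simp only [wv_1Q4] at this; linarith
  have hf : t * (t + 1) * (2 * t + 1) = 0 := by linear_combination (2 : ℝ) * hp
  rcases mul_eq_zero.1 hf with h' | h'
  · rcases mul_eq_zero.1 h' with h'' | h''
    · left; exact h''
    · right; left; linarith
  · right; right; linarith

/-- Likewise from `wv_1Q4 · 6 = v/2 + 3v²/2 + v³`: `v ∈ {0, -1, -1/2}`. -/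
theorem v_of_quad_wv_eq_zeroQ4 (u v t : ℝ) (h : quad_1Q4 (wv_1Q4 u v t) = 0) : v = 0 ∨ v = -1 ∨ v = -1 / 2 := by
  have hm := quad_1_marginQ4 (wv_1Q4 u v t)
  rw [h] at hm
  have hle : (wv_1Q4 u v t 6) ^ 2 ≤ ∑ i ∈ range 28, (wv_1Q4 u v t i) ^ 2 :=
    Finset.single_le_sum (f := fun i => (wv_1Q4 u v t i) ^ 2) (fun i _ => sq_nonneg _) (by simp)
  have hz : wv_1Q4 u v t 6 = 0 := by nlinarith [sq_nonneg (wv_1Q4 u v t 6)]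
  have hp : ((1 : ℝ)/2) * v + ((3 : ℝ)/2) * v ^ 2 + (1 : ℝ) * v ^ 3 = 0 := by
    have := hz; simp only [wv_1Q4] at this; linarith
  have hf : v * (v + 1) * (2 * v + 1) = 0 := by linear_combination (2 : ℝ) * hp
  rcases mul_eq_zero.1 hf with h' | h'
  · rcases mul_eq_zero.1 h' with h'' | h''
    · left; exact h''
    · right; left; linarith
  · right; right; linarith

end Summit.Ventures.PackingBounds.Energy.FivePointQuartic
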